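import Summits.Ventures.PercRepro2.CaseOneHB1Siblings
import Summits.Ventures.PercRepro2.CaseOneHB1AvoidO

/-!
# The aggregate form of `hB1`: `b₁ · c₁₀ ≤ β₀ · c₄` (blind cell PercRepro2, p1 g36; P1-HB1.md §3″)

With `b₁ = c₁ + c₄ + c₇ = P(Q₀, b ∈ C₁)` and `β₀ = c₃ + c₆ + c₉ + c₁₀ = P(Q₀, b ∉ U)`:
**`b₁ · c₁₀ ≤ β₀ · c₄`** (`HB1_aggregate`) — the `o`-free two-mark avoidance inequality
`TwoMarkO.twoMark` with the source `b`, the marks `a₁`, `o` and `X = Y = {a₂}`: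
`L1 {a₂} = {b ↔ a₁, b ↮ a₂} = {cellIdx ∈ {1, 4, 7}}`, `L2 {a₂} = cell 10`, `R1 {a₂} = cell 4`,
`R2 {a₂} = {b ↮ a₁, b ↮ a₂, a₁ ↮ a₂} = {cellIdx ∈ {3, 6, 9, 10}}`. It sharpens P1-G35 §6.2's
census-clean `M · c₄ ≥ b₁ · c₁₀` (`M = Σ cᵢ ≥ β₀`) and is the first-order condition of `hB1` at a
pendant `o` (P1-HB1 §4: the derivative of the margin in the weight of a new edge `o–v`). Standard
axioms. -/

namespace Summit.Ventures.PercRepro2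

namespace CaseOne

section Cells

variable {V : Type*} {E : Type*}

/-- Cell `7` unpacked: `a₁ ↮ a₂`, `o ∈ C(a₂)`, `b ∈ C(a₁)`. -/
lemma of_cellIdx_eq_seven {ends : E → Sym2 V} {ω : Config E} {o a₁ a₂ b : V}
    (h : cellIdx ends ω o a₁ a₂ b = 7) :
    ¬ Conn ends ω a₁ a₂ ∧ Conn ends ω a₂ o ∧ Conn ends ω a₁ b := by
  obtain ⟨hQ, h'⟩ := status_of_cellIdx (by norm_num) (by norm_num) h
  rcases status_cases ends ω a₁ a₂ o with ho | ho | ho <;>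
    rcases status_cases ends ω a₁ a₂ b with hb | hb | hb <;> rw [ho, hb] at h' <;> norm_num at h'
  exact ⟨hQ, (of_status_eq_two ho).2, conn_a1_of_status_eq_one hb⟩

/-- `b ∈ C(a₁)` on `Q₀`: the cell is `1`, `4` or `7`. -/
lemma cellIdx_mem_of_conn_b {ends : E → Sym2 V} {ω : Config E} {o a₁ a₂ b : V}
    (hQ : ¬ Conn ends ω a₁ a₂) (hb : Conn ends ω a₁ b) :
    cellIdx ends ω o a₁ a₂ b ∈ ({1, 4, 7} : Finset ℕ) := by
  have hsb : status ends ω a₁ a₂ b = 1 := by unfold status; rw [if_pos hb]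
  rw [cellIdx_eq_of_status hQ (fun h => by rw [hsb] at h; omega), hsb]
  rcases status_cases ends ω a₁ a₂ o with ho | ho | ho <;> rw [ho] <;> decide

/-- The cells `1`, `4`, `7` are `b ∈ C(a₁)` on `Q₀`. -/
lemma of_cellIdx_mem_b {ends : E → Sym2 V} {ω : Config E} {o a₁ a₂ b : V}
    (h : cellIdx ends ω o a₁ a₂ b ∈ ({1, 4, 7} : Finset ℕ)) :
    ¬ Conn ends ω a₁ a₂ ∧ Conn ends ω a₁ b := by
  simp only [Finset.mem_insert, Finset.mem_singleton] at h
  rcases h with h | h | h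
  · obtain ⟨hQ, hb, -, -⟩ := of_cellIdx_eq_one h; exact ⟨hQ, hb⟩
  · obtain ⟨hQ, -, hb⟩ := of_cellIdx_eq_four h; exact ⟨hQ, hb⟩
  · obtain ⟨hQ, -, hb⟩ := of_cellIdx_eq_seven h; exact ⟨hQ, hb⟩

/-- `b ∉ C(a₁) ∪ C(a₂)` on `Q₀`: the cell is `3`, `6`, `9` or `10`. -/
lemma cellIdx_mem_of_not_conn_b {ends : E → Sym2 V} {ω : Config E} {o a₁ a₂ b : V}
    (hQ : ¬ Conn ends ω a₁ a₂) (hb1 : ¬ Conn ends ω a₁ b) (hb2 : ¬ Conn ends ω a₂ b) :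
    cellIdx ends ω o a₁ a₂ b ∈ ({3, 6, 9, 10} : Finset ℕ) := by
  have hsb : status ends ω a₁ a₂ b = 0 := status_eq_zero_iff.2 ⟨hb1, hb2⟩
  rcases status_cases ends ω a₁ a₂ o with ho | ho | ho
  · unfold cellIdx
    rw [if_neg hQ, if_pos ⟨ho, hsb⟩]
    by_cases hob : Conn ends ω o b
    · rw [if_pos hob]; decide
    · rw [if_neg hob]; decide
  · rw [cellIdx_eq_of_status hQ (fun h => by rw [ho] at h; omega), ho, hsb]; decide
  · rw [cellIdx_eq_of_status hQ (fun h => by rw [ho] at h; omega), ho, hsb]; decide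

/-- The cells `3`, `6`, `9`, `10` are `b ∉ C(a₁) ∪ C(a₂)` on `Q₀`. -/
lemma of_cellIdx_mem_not_b {ends : E → Sym2 V} {ω : Config E} {o a₁ a₂ b : V}
    (h : cellIdx ends ω o a₁ a₂ b ∈ ({3, 6, 9, 10} : Finset ℕ)) :
    ¬ Conn ends ω a₁ a₂ ∧ ¬ Conn ends ω a₁ b ∧ ¬ Conn ends ω a₂ b := by
  simp only [Finset.mem_insert, Finset.mem_singleton] at h
  rcases h with h | h | h | h
  · obtain ⟨hQ, -, hb1, hb2⟩ := of_cellIdx_eq_three h; exact ⟨hQ, hb1, hb2⟩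
  · obtain ⟨hQ, -, hb1, hb2⟩ := of_cellIdx_eq_six h; exact ⟨hQ, hb1, hb2⟩
  · obtain ⟨hQ, -, ⟨hb1, hb2⟩, -⟩ := of_cellIdx_eq_nine h; exact ⟨hQ, hb1, hb2⟩
  · obtain ⟨hQ, -, ⟨hb1, hb2⟩, -⟩ := of_cellIdx_eq_ten h; exact ⟨hQ, hb1, hb2⟩

end Cells

section Aggregate

variable {V : Type*} {E : Type*} [Fintype E] [DecidableEq E] [Fintype V] [DecidableEq V]
  {R : Type*} [CommRing R] [LinearOrder R] [IsStrictOrderedRing R]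

omit [Fintype E] [DecidableEq E] [DecidableEq V] in
/-- `{cellIdx ∈ {1, 4, 7}}` is `L1 {a₂}` of the `o`-free variant with the source `b`. -/
lemma cells_b_eq_L1O (ends : E → Sym2 V) (o a₁ a₂ b : V) :
    {ω : Config E | cellIdx ends ω o a₁ a₂ b ∈ ({1, 4, 7} : Finset ℕ)} =
      TwoMarkO.L1 ends Finset.univ b a₁ {a₂} := by
  ext ω
  simp only [Set.mem_setOf_eq, TwoMarkO.L1, Set.mem_inter_iff, mem_QEvent, mem_REvent,
    Finset.mem_singleton, forall_eq, TwoMark.conn_induced_univ]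
  constructor
  · intro h
    obtain ⟨hQ, hb⟩ := of_cellIdx_mem_b h
    exact ⟨conn_symm hb, fun h' => hQ (conn_trans hb h')⟩
  · rintro ⟨hb, hba⟩
    exact cellIdx_mem_of_conn_b (fun h' => hba (conn_trans hb h')) (conn_symm hb)

omit [Fintype E] [DecidableEq E] in
/-- Cell `10` is `L2 {a₂}` of the `o`-free variant with the source `b`. -/
lemma cell_ten_eq_L2O (ends : E → Sym2 V) (o a₁ a₂ b : V) :
    {ω : Config E | cellIdx ends ω o a₁ a₂ b = 10} =
      TwoMarkO.L2 ends Finset.univ b a₁ o {a₂} := by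
  ext ω
  simp only [Set.mem_setOf_eq, TwoMarkO.L2, Set.mem_inter_iff, mem_QEvent, mem_REvent,
    Finset.forall_mem_union, Finset.mem_singleton, forall_eq, TwoMark.conn_induced_univ]
  constructor
  · intro h
    obtain ⟨hQ, ⟨_, _⟩, ⟨hb1, hb2⟩, hob⟩ := of_cellIdx_eq_ten h
    exact ⟨⟨conn_symm hob, fun h' => hb1 (conn_symm h'), fun h' => hb2 (conn_symm h')⟩, hQ⟩
  · rintro ⟨⟨hbo, hba1, hba2⟩, hQ⟩
    exact cellIdx_eq_ten hQ (fun h' => hba1 (conn_trans hbo (conn_symm h')))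
      (fun h' => hba2 (conn_trans hbo (conn_symm h'))) (fun h' => hba1 (conn_symm h'))
      (fun h' => hba2 (conn_symm h')) (conn_symm hbo)

omit [Fintype E] [DecidableEq E] in
/-- Cell `4` is `R1 {a₂}` of the `o`-free variant with the source `b`. -/
lemma cell_four_eq_R1O (ends : E → Sym2 V) (o a₁ a₂ b : V) :
    {ω : Config E | cellIdx ends ω o a₁ a₂ b = 4} =
      TwoMarkO.R1 ends Finset.univ b a₁ o {a₂} := by
  ext ω
  simp only [Set.mem_setOf_eq, TwoMarkO.R1, Set.mem_inter_iff, mem_QEvent, mem_REvent,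
    Finset.forall_mem_insert, Finset.mem_singleton, forall_eq, TwoMark.conn_induced_univ]
  constructor
  · intro h
    obtain ⟨hQ, ho, hb⟩ := of_cellIdx_eq_four h
    exact ⟨⟨conn_symm hb, conn_trans (conn_symm hb) ho⟩, fun h' => hQ (conn_trans hb h')⟩
  · rintro ⟨⟨hba, hbo⟩, hba2⟩
    exact cellIdx_eq_four (fun h' => hba2 (conn_trans hba h')) (conn_trans (conn_symm hba) hbo)
      (conn_symm hba)

omit [Fintype E] [DecidableEq E] in
/-- `{cellIdx ∈ {3, 6, 9, 10}}` is `R2 {a₂}` of the `o`-free variant with the source `b`. -/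
lemma cells_not_b_eq_R2O (ends : E → Sym2 V) (o a₁ a₂ b : V) :
    {ω : Config E | cellIdx ends ω o a₁ a₂ b ∈ ({3, 6, 9, 10} : Finset ℕ)} =
      TwoMarkO.R2 ends Finset.univ b a₁ {a₂} := by
  ext ω
  simp only [Set.mem_setOf_eq, TwoMarkO.R2, Set.mem_inter_iff, mem_REvent,
    Finset.forall_mem_union, Finset.mem_singleton, forall_eq, TwoMark.conn_induced_univ]
  constructor
  · intro h
    obtain ⟨hQ, hb1, hb2⟩ := of_cellIdx_mem_not_b h
    exact ⟨⟨fun h' => hb1 (conn_symm h'), fun h' => hb2 (conn_symm h')⟩, hQ⟩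
  · rintro ⟨⟨hba1, hba2⟩, hQ⟩
    exact cellIdx_mem_of_not_conn_b hQ (fun h' => hba1 (conn_symm h'))
      (fun h' => hba2 (conn_symm h'))

/-- **The aggregate form of `hB1`**: `(c₁ + c₄ + c₇) · c₁₀ ≤ (c₃ + c₆ + c₉ + c₁₀) · c₄`, i.e.
`P(Q₀, b ∈ C₁) · P(Q₀, o, b ∉ U, o ↔ b) ≤ P(Q₀, b ∉ U) · P(Q₀, o, b ∈ C₁)`. -/
theorem HB1_aggregate (p : E → R) (hp : IsProbVec p) (ends : E → Sym2 V) (o a₁ a₂ b : V) :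
    (cellMass p ends o a₁ a₂ b 1 + cellMass p ends o a₁ a₂ b 4 + cellMass p ends o a₁ a₂ b 7) *
        cellMass p ends o a₁ a₂ b 10 ≤
      (cellMass p ends o a₁ a₂ b 3 + cellMass p ends o a₁ a₂ b 6 + cellMass p ends o a₁ a₂ b 9 +
        cellMass p ends o a₁ a₂ b 10) * cellMass p ends o a₁ a₂ b 4 := by
  have e1 : ∑ k ∈ ({1, 4, 7} : Finset ℕ), cellMass p ends o a₁ a₂ b k =
      cellMass p ends o a₁ a₂ b 1 + cellMass p ends o a₁ a₂ b 4 + cellMass p ends o a₁ a₂ b 7 := by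
    rw [Finset.sum_insert (by decide), Finset.sum_insert (by decide), Finset.sum_singleton]
    ring
  have e2 : ∑ k ∈ ({3, 6, 9, 10} : Finset ℕ), cellMass p ends o a₁ a₂ b k =
      cellMass p ends o a₁ a₂ b 3 + cellMass p ends o a₁ a₂ b 6 + cellMass p ends o a₁ a₂ b 9 +
        cellMass p ends o a₁ a₂ b 10 := by
    rw [Finset.sum_insert (by decide), Finset.sum_insert (by decide), Finset.sum_insert (by decide),
      Finset.sum_singleton]
    ring
  have h10 : prob p {ω : Config E | cellIdx ends ω o a₁ a₂ b = 10} =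
      cellMass p ends o a₁ a₂ b 10 := rfl
  have h4 : prob p {ω : Config E | cellIdx ends ω o a₁ a₂ b = 4} =
      cellMass p ends o a₁ a₂ b 4 := rfl
  have h := TwoMarkO.twoMark p hp ends b a₁ o {a₂} {a₂}
  rw [Finset.inter_self, Finset.union_self, ← cells_b_eq_L1O, ← cell_ten_eq_L2O,
    ← cell_four_eq_R1O, ← cells_not_b_eq_R2O, prob_cellIdx_mem, prob_cellIdx_mem, e1, e2, h10,
    h4, mul_comm (cellMass p ends o a₁ a₂ b 4)] at h
  exact h

end Aggregate

end CaseOne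

end Summit.Ventures.PercRepro2
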